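import Summits.ValiantsHypothesis.ValiantsHypothesis.Theorems.BarrierLeverGradientGenericFibreCountHBasis

/-!
# Route BarrierLever — item `GradientGenericFibreCount` (stmt-ValiantsHypothesis-19256),
# part 2/6: the dimension count `dim S/(F) = Σ_t (dim S_t − dim (H)_t)`

`trunc I T = I ∩ S_{≤ T}`; a filtration argument (`finrank_trunc_step`, `finrank_trunc_eq_sum`,
`exists_reduce`, `finrank_quotient_add`) giving `hbasis_finrank`: for an H-basis situation
(part 1) `dim_K S_{≤T}/(I ∩ S_{≤T}) = Σ_{t ≤ T} (dim S_t − dim (H)_t)`.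

Lean text authored by the cell planner seat `valiant-natproofs-p2` (gen 4, HOME/HBasis-p2g4.lean,
1431 lines, kernel-checked rc 0 / 0 sorries; referee REF-G12 §4 and REF-G13 §2 PASS incl. full
line-read), ported by the prover seat (namespace `…Theorems.BarrierLever.HBasis`, six files, split
only). Stated over a general field `K` where the scratch does.

WHAT THIS IS NOT: nothing here touches FSV Question 6 / crux stmt-14610 or `VP` vs `VNP`; the item
is the algebro-geometric half of `NaturalProofsAgainstAllLinearSizes` (stmt-20156), whose
complexity half is `NaturalProofsAgainstAllLinearSizesOfCount` (stmt-19261).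

References: Macaulay 1916 (H-bases); [CoxLittleOSheaUsing2005] Ch. 3 Thm. (5.5); Hartshorne III
Cor. 10.7 (generic smoothness, replaced here by the Jacobian/Kähler argument); tree files
`Koszul.RegularSequenceFirstHomology`, `ZeroDimensional.FinitenessTheorem`, `RegularLocalRing.SopRegular`.
-/

-- layout Summits/ValiantsHypothesis/ValiantsHypothesis forces the duplicated namespace component
set_option linter.dupNamespace false

open MvPolynomial Finset

namespace Summit.ValiantsHypothesis.ValiantsHypothesis.Theorems.BarrierLever.HBasis

variable {K : Type*} [Field K] {σ : Type*} {ι : Type*} [Fintype ι]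

/-! ## Dimension count: `dim S/(F) = Σ_t (dim S_t − dim (H)_t)` -/

section Counting

open Module Literature.RingTheory.MvPolynomial

/-- `I ∩ S_{≤ T}`. -/
noncomputable def trunc (I : Ideal (MvPolynomial σ K)) (T : ℕ) :
    Submodule K (MvPolynomial σ K) :=
  I.restrictScalars K ⊓ restrictTotalDegree σ K T

/-- Membership in `trunc I T`: in `I` and of degree `≤ T`. -/
theorem mem_trunc {I : Ideal (MvPolynomial σ K)} {T : ℕ} {p : MvPolynomial σ K} :
    p ∈ trunc I T ↔ p ∈ I ∧ p.totalDegree ≤ T := by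
  rw [trunc, Submodule.mem_inf, Submodule.restrictScalars_mem, mem_restrictTotalDegree]

/-- `trunc I T` is finite-dimensional (a submodule of `S_{≤ T}`). -/
instance trunc.finite [Finite σ] (I : Ideal (MvPolynomial σ K)) (T : ℕ) :
    Module.Finite K (trunc I T) :=
  Module.Finite.of_injective (Submodule.inclusion (inf_le_right : trunc I T ≤ _))
    (Submodule.inclusion_injective _)

/-- One filtration step: `dim (I ∩ S_{≤T'}) = dim N + dim J_{T'}`, `N` the part with vanishing
`T'`-component, provided top components of `I ∩ S_{≤ T'}` land in `J` and lift back. -/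
theorem finrank_trunc_step [Finite σ] (I J : Ideal (MvPolynomial σ K)) (T' : ℕ)
    (N : Submodule K (MvPolynomial σ K))
    (hN : ∀ p, p ∈ N ↔ p ∈ I ∧ p.totalDegree ≤ T' ∧ homogeneousComponent T' p = 0)
    (hHB : ∀ p ∈ I, p.totalDegree ≤ T' → homogeneousComponent T' p ∈ J)
    (hLift : ∀ q ∈ idealDegree J T',
      ∃ p ∈ I, p.totalDegree ≤ T' ∧ homogeneousComponent T' p = q) :
    finrank K (trunc I T') = finrank K N + finrank K (idealDegree J T') := by
  classical
  have hmaps : ∀ p : trunc I T',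
      (homogeneousComponent T').domRestrict (trunc I T') p ∈ idealDegree J T' := by
    intro p
    have hp := mem_trunc.1 p.2
    exact (mem_idealDegree).2 ⟨hHB _ hp.1 hp.2, homogeneousComponent_isHomogeneous _ _⟩
  let π : trunc I T' →ₗ[K] idealDegree J T' :=
    LinearMap.codRestrict _ ((homogeneousComponent T').domRestrict (trunc I T')) hmaps
  have hπ : ∀ p : trunc I T', (π p : MvPolynomial σ K) = homogeneousComponent T' (p : _) := by
    intro p; rfl
  have hrange : LinearMap.range π = ⊤ := by
    rw [LinearMap.range_eq_top]
    intro q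
    obtain ⟨p, hpI, hpdeg, hpq⟩ := hLift q.1 q.2
    refine ⟨⟨p, mem_trunc.2 ⟨hpI, hpdeg⟩⟩, ?_⟩
    apply Subtype.ext
    rw [hπ]
    exact hpq
  have hNle : N ≤ trunc I T' := by
    intro p hp
    have := (hN p).1 hp
    exact mem_trunc.2 ⟨this.1, this.2.1⟩
  have hker : LinearMap.ker π = Submodule.comap (trunc I T').subtype N := by
    ext p
    simp only [LinearMap.mem_ker, Submodule.mem_comap, Submodule.subtype_apply]
    have hp := mem_trunc.1 p.2
    rw [hN]
    constructor
    · intro h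
      have h' : homogeneousComponent T' (p : MvPolynomial σ K) = 0 := by
        rw [← hπ, h]; rfl
      exact ⟨hp.1, hp.2, h'⟩
    · rintro ⟨-, -, h⟩
      apply Subtype.ext
      rw [hπ, h]
      rfl
  have hrn := LinearMap.finrank_range_add_finrank_ker π
  rw [hrange, finrank_top, hker, (Submodule.comapSubtypeEquivOfLe hNle).finrank_eq] at hrn
  omega

/-- Base of the filtration. -/
theorem finrank_trunc_zero [Finite σ] (I J : Ideal (MvPolynomial σ K))
    (hHB : ∀ p ∈ I, p.totalDegree ≤ 0 → homogeneousComponent 0 p ∈ J)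
    (hLift : ∀ q ∈ idealDegree J 0,
      ∃ p ∈ I, p.totalDegree ≤ 0 ∧ homogeneousComponent 0 p = q) :
    finrank K (trunc I 0) = finrank K (idealDegree J 0) := by
  have h := finrank_trunc_step I J 0 ⊥ ?_ hHB hLift
  · simpa using h
  · intro p
    rw [Submodule.mem_bot]
    constructor
    · rintro rfl
      exact ⟨I.zero_mem, by simp, by simp⟩
    · rintro ⟨-, hdeg, h0⟩
      rw [homogeneousComponent_zero] at h0
      have hp : p = C (coeff 0 p) := totalDegree_eq_zero_iff_eq_C.1 (Nat.le_zero.1 hdeg)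
      rw [hp]
      exact h0

/-- `dim (I ∩ S_{≤T}) = Σ_{t ≤ T} dim J_t` when `J` is the ideal of top forms of `I` in the
H-basis sense (top components land in `J`, and forms of `J` lift). -/
theorem finrank_trunc_eq_sum [Finite σ] (I J : Ideal (MvPolynomial σ K))
    (hHB : ∀ t, ∀ p ∈ I, p.totalDegree ≤ t → homogeneousComponent t p ∈ J)
    (hLift : ∀ t, ∀ q ∈ idealDegree J t,
      ∃ p ∈ I, p.totalDegree ≤ t ∧ homogeneousComponent t p = q)
    (T : ℕ) :
    finrank K (trunc I T) = ∑ t ∈ Finset.range (T + 1), finrank K (idealDegree J t) := by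
  induction T with
  | zero => simpa using finrank_trunc_zero I J (hHB 0) (hLift 0)
  | succ T ih =>
    rw [Finset.sum_range_succ, ← ih]
    refine finrank_trunc_step I J (T + 1) (trunc I T) ?_ (hHB _) (hLift _)
    intro p
    rw [mem_trunc]
    constructor
    · rintro ⟨hpI, hdeg⟩
      exact ⟨hpI, by omega, homogeneousComponent_eq_zero _ _ (by omega)⟩
    · rintro ⟨hpI, hdeg, h0⟩
      refine ⟨hpI, ?_⟩
      by_cases hp : p = 0
      · simp [hp]
      · have := totalDegree_lt_of_homogeneousComponent_eq_zero hp hdeg h0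
        omega

/-- `dim S_{≤T} = Σ_{t ≤ T} dim S_t`. -/
theorem finrank_restrictTotalDegree_eq_sum [Finite σ] (T : ℕ) :
    finrank K (restrictTotalDegree σ K T) =
      ∑ t ∈ Finset.range (T + 1), finrank K (homogeneousSubmodule σ K t) := by
  have h := finrank_trunc_eq_sum (K := K) (σ := σ) (⊤ : Ideal (MvPolynomial σ K)) ⊤
    (fun t p _ _ => Submodule.mem_top)
    (fun t q hq => ⟨q, Submodule.mem_top, ((mem_idealDegree).1 hq).2.totalDegree_le,
      homogeneousComponent_eq_self ((mem_idealDegree).1 hq).2⟩) T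
  have htr : trunc (⊤ : Ideal (MvPolynomial σ K)) T = restrictTotalDegree σ K T := by
    apply le_antisymm inf_le_right
    exact fun p hp => ⟨Submodule.mem_top, hp⟩
  have hid : ∀ t, idealDegree (⊤ : Ideal (MvPolynomial σ K)) t = homogeneousSubmodule σ K t := by
    intro t
    apply le_antisymm inf_le_right
    exact fun p hp => ⟨Submodule.mem_top, hp⟩
  rw [htr] at h
  rw [h]
  exact Finset.sum_congr rfl fun t _ => by rw [hid]

/-- Reduction of representatives below degree `T`, given lifting of all forms of degree `> T`. -/
theorem exists_reduce (I : Ideal (MvPolynomial σ K)) (T : ℕ)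
    (hLift : ∀ t, T < t → ∀ q : MvPolynomial σ K, q.IsHomogeneous t →
      ∃ p ∈ I, p.totalDegree ≤ t ∧ homogeneousComponent t p = q)
    (p : MvPolynomial σ K) : ∃ p' : MvPolynomial σ K, p'.totalDegree ≤ T ∧ p - p' ∈ I := by
  suffices main : ∀ D : ℕ, ∀ p : MvPolynomial σ K, p.totalDegree ≤ D →
      ∃ p' : MvPolynomial σ K, p'.totalDegree ≤ T ∧ p - p' ∈ I from main _ p le_rfl
  intro D
  induction D using Nat.strong_induction_on with
  | _ D ih =>
    intro p hD
    by_cases hDT : D ≤ T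
    · exact ⟨p, hD.trans hDT, by simp⟩
    · obtain ⟨p₁, hp₁I, hp₁deg, hp₁top⟩ :=
        hLift D (by omega) _ (homogeneousComponent_isHomogeneous D p)
      have hr : (p - p₁).totalDegree < D := by
        by_cases hr0 : p - p₁ = 0
        · rw [hr0, totalDegree_zero]; omega
        · refine totalDegree_lt_of_homogeneousComponent_eq_zero hr0 ?_ ?_
          · exact (totalDegree_sub _ _).trans (max_le hD hp₁deg)
          · rw [map_sub, hp₁top, sub_self]
      obtain ⟨p', hp'deg, hp'I⟩ := ih _ hr (p - p₁) le_rfl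
      refine ⟨p', hp'deg, ?_⟩
      have : p - p' = (p - p₁ - p') + p₁ := by ring
      rw [this]
      exact I.add_mem hp'I hp₁I

/-- `S/I` is finite-dimensional with `dim S/I + dim (I ∩ S_{≤T}) = dim S_{≤T}` as soon as all
forms of degree `> T` lift into `I`. -/
theorem finrank_quotient_add [Finite σ] (I : Ideal (MvPolynomial σ K)) (T : ℕ)
    (hLift : ∀ t, T < t → ∀ q : MvPolynomial σ K, q.IsHomogeneous t →
      ∃ p ∈ I, p.totalDegree ≤ t ∧ homogeneousComponent t p = q) :
    Module.Finite K (MvPolynomial σ K ⧸ I) ∧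
      finrank K (MvPolynomial σ K ⧸ I) + finrank K (trunc I T) =
        finrank K (restrictTotalDegree σ K T) := by
  classical
  let Q : Submodule K (MvPolynomial σ K) := I.restrictScalars K
  let φ : restrictTotalDegree σ K T →ₗ[K] MvPolynomial σ K ⧸ Q :=
    Q.mkQ ∘ₗ (restrictTotalDegree σ K T).subtype
  have hφ : ∀ p : restrictTotalDegree σ K T, φ p = Q.mkQ (p : MvPolynomial σ K) := fun p => rfl
  have hsurj : Function.Surjective φ := by
    intro x
    obtain ⟨p, rfl⟩ := Submodule.Quotient.mk_surjective Q x
    obtain ⟨p', hp'deg, hp'I⟩ := exists_reduce I T hLift p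
    refine ⟨⟨p', (mem_restrictTotalDegree _ _ _).2 hp'deg⟩, ?_⟩
    rw [hφ, Submodule.mkQ_apply]
    exact (Submodule.Quotient.eq Q).2 (by
      have := I.neg_mem hp'I
      rwa [neg_sub] at this)
  have hker : LinearMap.ker φ = Submodule.comap (restrictTotalDegree σ K T).subtype (trunc I T) := by
    ext p
    rw [LinearMap.mem_ker, Submodule.mem_comap, Submodule.subtype_apply, hφ, Submodule.mkQ_apply,
      Submodule.Quotient.mk_eq_zero, mem_trunc]
    exact ⟨fun h => ⟨h, (mem_restrictTotalDegree _ _ _).1 p.2⟩, fun h => h.1⟩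
  have hfin : Module.Finite K (MvPolynomial σ K ⧸ Q) := Module.Finite.of_surjective φ hsurj
  have hrn := LinearMap.finrank_range_add_finrank_ker φ
  have hle : trunc I T ≤ restrictTotalDegree σ K T := inf_le_right
  rw [LinearMap.range_eq_top.2 hsurj, finrank_top, hker,
    (Submodule.comapSubtypeEquivOfLe hle).finrank_eq] at hrn
  let E := Submodule.Quotient.restrictScalarsEquiv K I
  refine ⟨Module.Finite.equiv E, ?_⟩
  rw [← E.finrank_eq]
  exact hrn

/-- **H-basis dimension count** (memo §4b, M-Hbasis): for `F = H + (lower)`, `H` forms of degree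
`e ≥ 1` with vanishing first Koszul homology and `(H) ⊇ S_t` for `t > T`, the quotient `S/(F)` is
finite-dimensional and `dim S/(F) = Σ_{t ≤ T} (dim S_t − dim (H)_t)` — independently of the lower
order terms (in particular `dim S/(F − c)` is the same for every `c`). -/
theorem hbasis_finrank [Finite σ] {e : ℕ} (he : 1 ≤ e) (H F : ι → MvPolynomial σ K)
    (hH : ∀ i, (H i).IsHomogeneous e) (hF : ∀ i, (F i - H i).totalDegree < e)
    (hK : Literature.RingTheory.Koszul.HasKoszulSyzygies H) {T : ℕ}
    (htop : ∀ t, T < t → ∀ m : MvPolynomial σ K, m.IsHomogeneous t →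
      m ∈ Ideal.span (Set.range H)) :
    Module.Finite K (MvPolynomial σ K ⧸ Ideal.span (Set.range F)) ∧
      finrank K (MvPolynomial σ K ⧸ Ideal.span (Set.range F)) +
          ∑ t ∈ Finset.range (T + 1), finrank K (idealDegree (Ideal.span (Set.range H)) t) =
        ∑ t ∈ Finset.range (T + 1), finrank K (homogeneousSubmodule σ K t) := by
  obtain ⟨hfin, hq⟩ := finrank_quotient_add (Ideal.span (Set.range F)) T (fun t ht q hq =>
    exists_lift_of_mem_idealDegree H F hH hF t q ((mem_idealDegree).2 ⟨htop t ht q hq, hq⟩))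
  refine ⟨hfin, ?_⟩
  rw [← finrank_restrictTotalDegree_eq_sum, ← hq, finrank_trunc_eq_sum _ _
    (fun t p hp hpt => homogeneousComponent_mem_span_of_mem_span H F he hH hF hK hp hpt)
    (fun t q hq => exists_lift_of_mem_idealDegree H F hH hF t q hq)]

end Counting

end Summit.ValiantsHypothesis.ValiantsHypothesis.Theorems.BarrierLever.HBasis
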